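import Mathlib
import HarnessLib
import HarnessLib.Audit
import Summits.Langlands.Statement
import Literature.NumberTheory.GaloisRepresentations.CrystallineOrdinary
import Literature.NumberTheory.Automorphic.LocalLanglandsGLProofs
import Literature.NumberTheory.Automorphic.LocalConstantsProofs
import Literature.NumberTheory.GaloisRepresentations.LocalGaloisGroupProofs
import Literature.NumberTheory.GaloisRepresentations.LocalGaloisGroupFrobeniusProofs
import HarnessLib.Audit.Status.Attr

/-!
Route: OrdinaryPrimeTransport

# Route OrdinaryPrimeTransport — irreducibility of ρ_π at every prime for non-self-dual GL_p over CM
from one ordinary prime, by semisimple-rank rigidity in prime rank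

X = IrreduciblePrimeRank (the summit's irreducibility clause of direction (A) on the PRIME-RANK
SECTOR): for K totally real or CM, p an odd prime, π cuspidal L-algebraic on GL_p(𝔸_K) with regular
infinity type and NOT essentially self-dual at Satake level (no Hecke character η with t_π⁻¹ = η·t_π
a.e.), EVERY ℓ-adic avatar ρ : Γ_K → GL_p(ℚ̄_ℓ) Satake–Frobenius compatible with (π, ι) at almost
all places is irreducible — at every ℓ and every ι (the printed "cuspidal ⇒ irreducible" conjecture:
AHTW arXiv:2607.11763 Rem. 1.3 p. 7; Shavali arXiv:2603.19768 §1; Böckle–Hui arXiv:2404.08954 §1.2;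
Ramakrishnan math/0609460). It suffices to show X because, with the in-ledger open components
IrreducibleOffPrimeRankSector (irreducibility off this sector) and ReciprocityUpToIrreducibility
(the rest of the mountain, verbatim stmt-Langlands-14328), the deciding theorem `closes` derives
`Langlands` (uniqueness up to conjugacy = support item IrreducibleAvatarsConjugate, Chebotarev +
Brauer–Nesbitt). X itself is OBTAINED from the four cruxes: one ORDINARY prime exists
(OrdinaryPrimeExists) ⇒ at that prime every irreducible exact summand of a compatible avatar is
strongly potentially automorphic (SummandsPotentiallyAutomorphic: Qian's ordinary potential
automorphy, weights free) ⇒ a purity-free Rankin–Selberg pole/abscissa count forbids reducibility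
there (RankinSelbergPoleCountR, ranks ≥ 2) ⇒ Hui's λ-independence of the semisimple rank transports
irreducibility to EVERY prime because p is prime (PrimeRankTransport).
Lean: `∀ (K : Type) [Field K] [NumberField K], (NumberField.IsTotallyReal K ∨ NumberField.IsCMField
K) → ∀ (p : ℕ), Nat.Prime p → 3 ≤ p → ∀ (hcpt :
Literature.NumberTheory.Automorphic.isCompact_glFiniteIntegralLevel p K) (π :
Literature.NumberTheory.Automorphic.CuspidalAutomorphicRepData p K hcpt), π.1.IsLAlgebraic → (∃ T :
Literature.NumberTheory.Automorphic.InfinityType K p, π.1.HasInfinityType T ∧ T.IsRegular) → (∀ (h1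
: Literature.NumberTheory.Automorphic.isCompact_glFiniteIntegralLevel 1 K) (η :
Literature.NumberTheory.Automorphic.CuspidalAutomorphicRepData 1 K h1), ¬ (∀ᶠ v :
IsDedekindDomain.HeightOneSpectrum (NumberField.RingOfIntegers K) in Filter.cofinite, ∀ α : Multiset
ℂ, π.1.HasSatakeParamAt v α → ∃ e : ℂ, η.1.HasSatakeParamAt v {e} ∧ α.map (fun a => a⁻¹) = α.map
(fun a => e * a))) → ∀ (ℓ : ℕ) [Fact ℓ.Prime] (ι : PadicAlgCl ℓ ≃+* ℂ) (ρ :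
Literature.NumberTheory.GaloisRepresentations.FramedGaloisRep K (PadicAlgCl ℓ) p), (∀ᶠ v :
IsDedekindDomain.HeightOneSpectrum (NumberField.RingOfIntegers K) in Filter.cofinite,
Summit.Langlands.SatakeFrobCompatibleAt ι π.1 ρ v) → ρ.toGaloisRep.IsIrreducible`

## Assembly
Pure logic, CHECKED (Sketch.lean rc 0, 2026-08-16, re-certified after the rank-guard repair of #4;
glue.lean is the deciding theorem): `theorem closes (hPA : SummandsPotentiallyAutomorphic) (hOrd :
OrdinaryPrimeExists) (hRS : RankinSelbergPoleCountR) (hT : PrimeRankTransport) (hOff :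
IrreducibleOffPrimeRankSector) (hE : ReciprocityUpToIrreducibility) (hU :
IrreducibleAvatarsConjugate) : Langlands`. Step 1 (irreducibility of every compatible avatar of
every L-algebraic cuspidal π): case split on the sector predicate; off the sector use hOff; on it,
hOrd gives (ℓ₀, ι₀, ρ₁ ordinary), then every compatible ρ₀ at ι₀ is irreducible (else hRS fires with
the strong potential automorphy supplied by hPA from ⟨ρ₁⟩), and hT transports to the given (ℓ, ι,
ρ). Step 2 (E ∧ irreducibility ⇒ Langlands): take Rec from hE; (B) verbatim; for (A) the avatar ρ of
hE is irreducible by Step 1, geometric and corresponding as given, and unique up to conjugacy among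
corresponding ρ' by hU (both irreducible, same Satake–Frobenius data a.e.). CONE REPAIR 2026-08-16:
uniqueness is the support item, not an inline proof, so the route file imports none of
LAdicRepFrobenius / ChebotarevArtinRepHolds / AutomorphicRepsGLSatakeFlathProofs (their closures
carried TunnellLemma, StrongArtinGL2, JacquetLanglandsParts, AutomorphicGLn: 48 unproved facts, none
used by the line).

Rationale: WHY THIS LINE. Printed open question attacked (operator A, open-question harvest): irreducibility of
r_(π,ι) for non-polarized regular algebraic cuspidal π, at EVERY prime (AHTW arXiv:2607.11763 Rem.
1.3, 2026; Shavali arXiv:2603.19768 p. 3; BockleHui2025 §1.2) — known only at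
density-one/positive-density sets of ι (arXiv:1307.1640, arXiv:1010.2561) or for n ≤ 4 totally real
by L-function identities. Mechanism = three levers from the theory of compatible systems and from
non-self-dual potential automorphy, none used by any open route of this summit: (1) Serre–Hui
Frobenius tori: the semisimple rank of the algebraic monodromy group of the E-rational compatible
system (r_(π,λ))_λ is INDEPENDENT of λ (Hui arXiv:1204.5271 Thm 3.19, any semisimple compatible
system), so in PRIME rank p a reducible λ (ss-rank ≤ p−2 inside GL_k × GL_(p−k)) is incompatible
with one prime λ₀ where G^der = SL_p; the latter follows at λ₀ from irreducibility + AHTW's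
Hodge–Tate regularity (weight-multiplicity-free tautological representation) + primality
(prime-dimensional multiplicity-free irreps are SL_p, Sym^(p−1) SL_2, SO_p, G_2 — the last three
self-dual, excluded by non-essential-self-duality) — Hui arXiv:2208.04002 §4.4.1 runs exactly this
rank count in the polarized cases n ≤ 6; (2) the ONE prime is chosen ORDINARY: at an ordinary prime
every summand of r_(π,λ₀) is ordinary with regular (sub-pattern, non-consecutive) Hodge–Tate weights
and de Rham (AHTW Thm 1.2.1 + Cor. 1.2.2), which is precisely the input of Qian's
single-representation potential automorphy for GL_k over CM fields (arXiv:2104.09761 Thm 1.4 + ACC+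
arXiv:1812.09999 Thm 6.1.2; Hida-theoretic weight change) — at Fontaine–Laffaille primes the
non-polarizable world has no weight change (Dwork weights are consecutive), which is why earlier
non-self-dual results stop at density statements; (3) a Rankin–Selberg pole count à la
Patrikis–Taylor made PURITY-FREE: if r = σ ⊕ τ with strongly potentially automorphic summands,
Brauer induction writes the formal Euler products D_(σ⊗σ̄), D_(τ⊗τ̄), D_(σ⊗τ̄) as integral
combinations of automorphic Rankin–Selberg L-functions over the Brauer subfields; if the summands
have different weights (Ramanujan for π is unknown!) D_(σ⊗σ̄) has a pole to the RIGHT of 1 where the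
other three factors converge absolutely and do not vanish, contradicting holomorphy of L^S(s, π ×
π̄) on Re s > 1 (JacquetShalikaAJM1981); if they have equal weights the classical count ord_(s=1) ≤
−2 contradicts the simple pole (Shahidi non-vanishing on Re s = 1). Imported areas: algebraic groups
/ Frobenius tori (Serre's abelian ℓ-adic theory, Waldschmidt transcendence inside Hui's theorem),
non-self-dual Dwork families (Qian), analytic theory of Rankin–Selberg L-functions. Versus the hub:
IrreducibilityBySelfDuality (the only irreducibility route, n = 3 CM) forces self-duality by GL_3
pole identities and never leaves one prime; no route uses λ-independence or an ordinary prime as a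
resource. Negatives index (1 entry, K3 Serre-type anchor) unrelated.

RANKED CRUXES. #0 IrreduciblePrimeRank (target) — for K totally real or CM, p an odd prime, π
cuspidal L-algebraic on GL_p(𝔸_K) with regular infinity type, not essentially self-dual at Satake
level: every ρ : Γ_K → GL_p(ℚ̄_ℓ) Satake–Frobenius compatible with (π, ι) a.e. is irreducible, for
every ℓ, ι. (why it might fail: Open ('cuspidal ⇒ irreducible'); as typed it is implied by the
summit (Langlands ⇒ irreducibility of every compatible avatar, cf.
langlands_iff_reciprocityUpToIrreducibility_and_irreducible), so it closes exhausted, not refuted,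
unless the Satake-level non-self-duality clause is mistyped.) [arXiv:2607.11763, arXiv:2603.19768,
arXiv:2404.08954, arXiv:math/0609460, arXiv:2208.04002]
#2 SummandsPotentiallyAutomorphic (crux) — (the heart; Qian's ordinary potential automorphy run on
SUMMANDS) K TR or CM, p odd prime, π as above; ℓ₀, ι₀ such that SOME compatible avatar ρ₁ is
crystalline-ordinary (full flag, unramified · ε^b diagonal, b strictly decreasing) at every v ∣ ℓ₀.
Then for every compatible avatar ρ₀ at ι₀, every 0 < k < p, every IRREDUCIBLE framed σ of rank k and
framed τ of rank p − k with charpoly ρ₀(g) = charpoly σ(g) · charpoly τ(g) for all g ∈ Γ_K (exact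
summand of ρ₀^ss), σ is STRONGLY potentially automorphic: there is a finite Galois CM extension F'/K
with σ|_(F') irreducible such that for every intermediate E with F'/E solvable there is a cuspidal
Π_E on GL_k(𝔸_E) Satake–Frobenius compatible with σ|_E a.e. [deps: OrdinaryPrimeExists] [difficulty:
open-problem] (why it might fail: Qian Thm 1.4 needs σ̄ abs. irreducible, decomposed generic,
enormous image, a scalar element; at a small or badly chosen ordinary prime a hypothetical summand
can be residually reducible (Hui 2023 Thm 1.2: type-A summands, almost all λ only); descent to each
E must fix the twist.) [arXiv:2104.09761, arXiv:1812.09999, arXiv:2208.04002, arXiv:2607.11763,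
ArthurClozelAMS120]
#3 OrdinaryPrimeExists (crux) — (the printed open input) for K TR or CM, p odd prime, π cuspidal
L-algebraic with regular infinity type on GL_p(𝔸_K): there exist a prime ℓ₀, ι₀ : ℚ̄_ℓ₀ ≃ ℂ and a
compatible avatar ρ₁ that is crystalline-ordinary (in the tree's full-flag cyclotomic-exponent sense
`IsCrystallineOrdinaryAt`) at every place v ∣ ℓ₀ — one ordinary prime (for non-parallel weights this
forces ℓ₀ split, which ordinary primes of density one would supply). [difficulty: open-problem] (why
it might fail: Even ONE ordinary prime is open for general π (Calegari arXiv:2109.14145 p.19: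
Hilbert case 'remains open'); density one of ordinary primes is only heuristic for large Hecke
fields; the full-flag predicate wants unramified diagonal characters and, for non-parallel weight, a
split ℓ₀.) [arXiv:2109.14145, doi:10.1112/mtk.70081, arXiv:2607.11763, Geraghty2018,
arXiv:1812.09999]
#4 RankinSelbergPoleCountR (crux; REPAIRED 2026-08-16: the unguarded RankinSelbergPoleCount,
stmt-Langlands-17212, was refuted-MISSTATED by
Theorems.OrdinaryPrimeTransportRankinSelbergPoleCount_refuted at the degenerate rank n = 0 — π₀ =
ℂ·1/0 on GL_0(𝔸_ℚ), ρ₀ = 1 of rank 0 — and stays in the ledger as a settled negative; the repaired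
item is the same statement with the guard 2 ≤ n) — (purity-free Patrikis–Taylor count; any n ≥ 2,
any number field K) π cuspidal on GL_n(𝔸_K), ρ₀ a compatible avatar at ι₀ that is NOT irreducible,
such that every irreducible exact framed summand σ (0 < k < n, charpoly ρ₀ = charpoly σ · charpoly τ
on Γ_K) is strongly potentially automorphic (as in SummandsPotentiallyAutomorphic) — contradiction.
Proof line: decompose ρ₀^ss = ⊕σ_i (m ≥ 2); Brauer over Gal(F'/K) writes D_(σ_i⊗σ̄_j)(s) = ∏_E
L^S(s, Π^i_E × Π̄^j_E ⊗ χ_E)^(n_E); unequal weights ⇒ D_(σ_i⊗σ̄_i) has a pole at 1+δ_i > 1 where the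
other factors are absolutely convergent and non-zero ⇒ L^S(s, π×π̄) would have a pole on Re s > 1;
equal weights ⇒ ord_(s=1) L^S(π×π̄) ≤ −m ≤ −2 against the simple pole (JS) using Shahidi
non-vanishing on Re s = 1. [difficulty: L] (why it might fail: Normalisation traps: compatibility is
in the arithmetic-Frobenius L-normalisation, JS/Shahidi are unitary — offsets δ_i must be read off
|det σ_i|; Euler products converge absolutely only on Re s > 2 (JS bounds) before continuation;
self-twists Π_E ≅ Π_E⊗χ_E add poles counted by dim End(σ_i).) [arXiv:1307.1640,
doi:10.4007/annals.2014.179.2.3, JacquetShalikaAJM1981, ShahidiAJM1981,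
doi:10.4007/annals.2010.171.779]
#5 PrimeRankTransport (crux) — (Hui transport in prime rank) K TR or CM, p odd prime, π cuspidal
L-algebraic with regular infinity type, not essentially self-dual at Satake level; if at ONE prime
(ℓ₀, ι₀) every compatible avatar is irreducible, then at EVERY (ℓ, ι) every compatible avatar is
irreducible. Proof line: the avatars form a semisimple E-rational Serre compatible system (Clozel;
HLTT/Scholze; p odd so L = C-algebraic); torus case (G⁰ a torus): Serre's abelian theory ⇒ induced
from one Hecke character of a degree-p extension, irreducible at all λ iff at one; else Clifford + p
prime ⇒ Lie-irreducible at λ₀, Hodge–Tate regular (AHTW Thm 1.2.1, via a CM quadratic extension when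
K is totally real) ⇒ weight-multiplicity-free prime-dimensional irrep of a simple group ⇒ SL_p
(std/dual), Sym^(p−1) SL_2, SO_p or G_2 (p = 7); the last three preserve a symmetric form, so G ⊂
GO_p and r ≅ r^∨ ⊗ c with c de Rham ⇒ π essentially self-dual at Satake level — excluded; hence
G^der_(λ₀) = SL_p of semisimple rank p − 1, λ-independent (Hui 2013 Thm 3.19), while a reducible λ
has semisimple rank ≤ p − 2. [difficulty: L] (why it might fail: Hui 2013 Thm 3.19 is stated for
ℚ-rational systems over all ℓ (E-rational λ-adic case = Rem. 1.8 only); the prime-dimensional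
multiplicity-free list must be complete incl. non-connected G; 'similitude c de Rham ⇒ Hecke
character ⇒ Satake self-duality a.e.' needs η over ALL GL(1) data.) [arXiv:1204.5271,
arXiv:2208.04002, arXiv:2607.11763, SerreAbelianLadic1968, arXiv:1411.6280,
HarrisLanTaylorThorneRMS2016]
#9 IrreducibleOffPrimeRankSector (support) — THE REST OF THE IRREDUCIBILITY CLAUSE (open component,
shared in spirit with stmt-Langlands-14329): for every n ≥ 1, number field K, cuspidal L-algebraic π
of GL_n(𝔸_K) NOT in the sector (K TR∨CM ∧ n odd prime ∧ regular infinity type ∧ not essentially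
self-dual), every a.e.-compatible avatar at every (ℓ, ι) is irreducible. Not attacked by this route;
implied by the summit; filed so that `closes` decides `Langlands` honestly (same convention as
IrreducibilityBySelfDuality.IrreducibleOffSector, EisensteinMonodromy.MonodromyToLanglands,
PicardMuOrdinary.SectorComplement). [difficulty: open-problem] [arXiv:math/0609460, BockleHui2025,
arXiv:2208.04002, BuzzardGeeLMS2014]
#9 ReciprocityUpToIrreducibility (support) — THE REST OF THE MOUNTAIN (verbatim the item
stmt-Langlands-14328 of route IrreducibilityBySelfDuality, so the ledger attaches this route to it):
for every number field F one datum Rec such that for every n ≥ 1, hcpt: every L-algebraic cuspidal π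
has, for all ℓ, ι, SOME geometric ρ with Corresponds Rec ι π ρ, and GaloisToAutomorphic n Rec hcpt
verbatim. Open (both directions minus irreducibility/uniqueness); implied by the summit; not
attacked here. [difficulty: open-problem] [BuzzardGeeLMS2014, FontaineMazurGeometric1995,
HarrisLanTaylorThorneRMS2016, arXiv:2109.14145]
#9 IrreducibleAvatarsConjugate (support) — UNIQUENESS UP TO CONJUGACY, filed as an item by the CONE
REPAIR of 2026-08-16 (formerly proved inline in `closes`): for every n, number field F, hcpt,
cuspidal π on GL_n(𝔸_F), ℓ, ι and framed ρ, ρ' : Γ_F → GL_n(ℚ̄_ℓ), both IRREDUCIBLE and both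
Satake–Frobenius compatible with (π, ι) a.e., IsConjugate ρ ρ'. Known (Deligne–Serre 1974 Lemme 3.2;
Serre, Abelian ℓ-adic reps I §2.3): Satake uniqueness ⇒ equal Frobenius polynomials a.e. ⇒ equal
traces on a dense set (Chebotarev) ⇒ equivalent (Brauer–Nesbitt, char 0, semisimple) ⇒ conjugate.
The one-line proof from LAdicRepFrobenius + ChebotarevArtinRepHolds +
AutomorphicRepsGLSatakeFlathProofs (pre-repair glue, rev 3;
Theorems/IrreducibilityBySelfDualityReciprocityUpToIrreducibility ←) drags TunnellLemma /
StrongArtinGL2 / JacquetLanglandsParts / AutomorphicGLn (48 unproved, unused facts) into the import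
cone and re-blocks the route when linked; the prover is asked to land it through light modules
(re-home the statement `chebotarev_artinRep` + `frobenius_dense` +
`nonempty_equiv_of_hasFrobCharpolyAt_eventually` away from TunnellLemma; prove
`hasSatakeParamAt_unique` without JacquetLanglandsParts / StrongMultiplicityOneSpherical; then
EquivOfCharacter + FramedRepEquivConj). [difficulty: M] [DeligneSerreASENS1974,
SerreAbelianLadic1968, TateGCFT1967, BuzzardGeeLMS2014]


TWO-LAYER PLAN. Foreseen (nothing filed now): PrimeRankTransport ⇐ TorusCase (G⁰ a torus: induced
from a Hecke character, Serre) → LieIrreducibleCase (Clifford + prime-dim multiplicity-free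
classification + Hui ss-rank) → PrimeRankTransport (glue = case split on whether some compatible
avatar becomes abelian on an open subgroup). RankinSelbergPoleCountR ⇐ FramedSplitting (continuous
semisimplification and block-diagonal framing of ⊕σ_i, any n) → BrauerBookkeeping (formal Euler
products D_(σ_i⊗σ̄_j) as integral combinations of automorphic RS L-functions, with the weight
offsets) → RankinSelbergPoleCountR. SummandsPotentiallyAutomorphic ⇐ ResidualGoodnessAtOrdinaryPrime
(summands at SOME ordinary prime satisfy Qian's residual hypotheses; may need 'infinitely many
ordinary primes' instead of one) → QianOnSummands → descent bookkeeping.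

KILL CRITERIA. (1) A refuter exhibits (even on paper) a weight-multiplicity-free irreducible
NON-self-dual prime-dimensional representation of a connected reductive group other than the
standard/dual of SL_p occurring as a Hodge–Tate-regular Galois image ⇒ PrimeRankTransport
refuted-substantive ⇒ restrict the sector (exclude that p) or close. (2) OrdinaryPrimeExists shown
false for a class of π (e.g. a provable everywhere-non-ordinary non-CM form) ⇒ pivot: replace the
ordinary prime by 'a prime at which π is potentially diagonalizable with weight change' once a
non-polarizable PD lifting theorem over CM exists, else close exhausted. (3) RankinSelbergPoleCountR
refuted through normalisations ⇒ misstated: restate with the unitary slopes a_i explicit (the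
rank-guard misstatement n = 0 of 2026-08-16 is already repaired; n = 1 is vacuous). (4) A published
all-λ irreducibility theorem for non-polarized GL_p over CM (search 2026-08-16: none beyond n ≤ 4
totally real) ⇒ close superseded/known. (5) The target and the two rank-9 supports are implied by
the summit: they close exhausted, never refuted, unless mistyped (refuters: attack the Satake-level
'not essentially self-dual' clause and the L-normalisation).

NOT DECOMPOSED YET. The residual hypotheses of Qian's theorem for hypothetical summands (decomposed
genericity, enormous image, scalar element) are NOT typed — they sit inside
SummandsPotentiallyAutomorphic's why-it-might-fail and would become a layer-2 child
'ResidualGoodnessAtOrdinaryPrime' only after a grounder confirms the tree's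
EnormousSubgroup/ResidualGaloisRep API suffices; the composite-rank case (n = 4: SL_2 ⊗ SL_2 images
of equal rank, Shavali) is deliberately outside the sector; the torus/induced case of the transport
is a child, not an item; the de Rham ⇒ Hecke-character step for the similitude character and the
CM-quadratic base change for totally real K are prover-level lemmas (--supports PrimeRankTransport).

CHEAPEST FALSIFIER. (a) Group theory, one hour by hand or `decide`-sized enumeration: list
weight-multiplicity-free irreducible representations of simple Lie algebras of PRIME dimension p ≤
31 (Howe's list: Sym^k/∧^k of type A, standard of B/C/D, spin, 7 of G_2, 27, 56) and check each
non-type-A-standard entry is self-dual — done by hand for p ∈ (3,5,7,11,13): only SL_p std/dual are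
non-self-dual (C(m,k) is never prime for 2 ≤ k ≤ m−2). (b) Consistency lookups (done): GL_2 over CM
irreducible (Taylor), GL_3 totally real all λ (BockleHui2025 Thm 1.2), GL_4 totally real
(arXiv:2603.19768, composite — outside sector) — no conflict. (c) For refuters: a CM-induced π =
AI(χ) on GL_3/ℚ(i) is essentially self-dual? No in general — check that such π (G⁰ a torus) is
handled by the torus branch: irreducible at one λ iff the three conjugates of χ are distinct,
λ-independent ✓.

NUMBERS. Semisimple ranks: SL_p has p − 1; any reductive subgroup of GL_k × GL_(p−k) has ≤ (k−1) +
(p−k−1) = p − 2 (0 < k < p). Prime-dimensional multiplicity-free irreps: dim Sym^k(ℂ^m) = C(m+k−1,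
k) and dim ∧^k(ℂ^m) = C(m, k) are composite for 2 ≤ k ≤ m − 2 (every prime factor of C(m,k) is ≤ m <
C(m,k)). Known all-λ irreducibility: n = 2 (Ribet/Taylor), n = 3 totally real (BockleHui2025), n = 4
totally real non-self-dual (arXiv:2603.19768), polarized n ≤ 6 almost all λ (arXiv:2208.04002);
density-one/positive density in general (arXiv:1307.1640, arXiv:1010.2561).

DEFINITION REQUESTS. None at open. Cite facts wanted later (as Literature named facts, for the
provers of PrimeRankTransport / RankinSelbergPoleCountR): Hui 2013 Thm 3.19 (λ-independence of the
formal character of (G_λ⁰)^der for semisimple E-rational compatible systems); AHTW arXiv:2607.11763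
Thm 1.2.1 (de Rham + Hodge–Tate regular + ss local–global compatibility at p for RACAR over CM);
Qian arXiv:2104.09761 Thm 1.4; JS81 simple pole of L^S(s, π × π̃) and Shahidi non-vanishing on Re s
= 1 for GL_k × GL_k'.

Novelty: Searches (2026-08-16): lit frontier Langlands --since 2022 (60 rows; read arXiv:2607.11763,
2603.19768, 2603.18961, 2605.03519, 2602.04778, 2008.09852, 1908.07073); lit read arXiv:2404.08954,
2208.04002, 1204.5271, 1411.6280, 1307.1640(meta), 2104.09761, 1901.05490, 1409.7007, 2109.14145,
2301.10509, 1212.3847; lit search --hybrid "irreducibility automorphic Galois representations all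
primes ordinary prime semisimple rank independence prime dimension" (10 generic book hits, none
relevant); lit galaxy search "irreducible for all primes" --star all (5 irrelevant hits); crossref
lookups Hui 2018/ Hui–Larsen 2016 / Larsen 1995 (maximality, density-one). lean search: no tree decl
on algebraic monodromy / λ-independence; hub routes: only IrreducibilityBySelfDuality touches
irreducibility (GL_3 CM, RS-pole self-duality lever).
Nearest prior art found: Hui arXiv:2208.04002 Prop. 4.16/4.17 + §4.4.1 (polarized n ≤ 6:
Lie-irreducible at one λ₁ + formal-character independence ⇒ G^der = SL_n and irreducible at all λ;
the starting λ₁ comes from potential automorphy at LARGE λ, hence 'almost all λ' overall);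
Patrikis–Taylor arXiv:1307.1640 (positive density via potential automorphy of summands of PURE
polarized systems); Qian arXiv:2104.09761 Thm 1.4 (ordinary non-self-dual potential automorphy,
never applied to summands/irreducibility); Shavali arXiv:2603.19768 (GL_4 totally real by
exterior-square L-functions).
Delta: non-polarized GL_p over CM at EVERY prime from ONE ordinary prime — pri  [refs: 2607.11763, 2404.08954, 2208.04002, 1307.1640, 2104.09761, 2603.19768]

Barriers (technique_class: lambda-independence ordinary-PA rankin-selberg-poles): - technique_class: lambda-independence ordinary-PA rankin-selberg-poles
- Literature.Barriers.Langlands.TwistedEndoscopySelfDual: evaded — the sector is the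
NON-(essentially-)self-dual one and no endoscopic transfer is used; existence of r_(π,ι) is
HLTT/Scholze (congruences), potential automorphy of summands is Qian's non-self-dual Dwork family,
the transport is Galois-theoretic.
- Literature.Barriers.Langlands.TaylorWilesNumericalCoincidence: the only automorphy-lifting input
(inside Qian Thm 1.4) is ACC+ Thm 6.1.2, a Calegari–Geraghty-type ordinary theorem over CM fields
built for l₀ > 0; the bet is that its residual hypotheses hold for hypothetical summands at SOME
ordinary prime (why-it-might-fail of the rank-2 crux).
- Literature.Barriers.Langlands.ResiduallyReducibleBarrier: it does bite the rank-2 crux at badly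
chosen primes (a summand may be residually reducible); evasion = freedom to choose the ordinary
prime outside the finite exceptional set of Hui 2023 Thm 1.2 once infinitely many ordinary primes
are available — recorded as the foreseen child ResidualGoodnessAtOrdinaryPrime.
- Literature.Barriers.Langlands.PatchingLocalComponentBarrier: evaded by ordinarity — Hida-theoretic
weight change puts every ordinary summand on the ordinary component; no potential diagonalizability
is needed.
- Literature.Barriers.Langlands.NonRegularWeightBarrier: not applicable — the sector is regular
algebraic; AHTW supplies Hodge–Tate regularity of r_(π,ι) and of its summands.
- Literat

History (route lifecycle, newest last):
- 2026-08-16T23:18:19Z · rev 6: restated Assembly (stmt-Langlands-17215) — cone repair (route-repair planner 2026-08-16): Assembly restated to carry the new support hypothesis IrreducibleAvatarsConjugate, matching the re-certified clos (planner-rrepair-Langlands-OrdinaryPrimeTranspo-5b5addaa-0)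
- 2026-08-16T23:31:35Z · BROKEN — RankinSelbergPoleCount (stmt-Langlands-17212, crux) refuted by Summit.Langlands.Langlands.Theorems.OrdinaryPrimeTransportRankinSelbergPoleCount_refuted @ 69e40edcb98b (refuter-rreview-0816T22-2-0)
- 2026-08-16T23:48:31Z · rev 11: restated Assembly (stmt-Langlands-17399) — repair (route-repair rfix 5b5addaa): RankinSelbergPoleCount (stmt-Langlands-17212, crux rank 4) was refuted-MISSTATED by Summit.Langlands.Langlands.Theorems.Ord (planner-rfix-Langlands-OrdinaryPrimeTranspor-5b5addaa-0)
- 2026-08-16T23:48:31Z · rev 11: dropped RankinSelbergPoleCount — repair (route-repair rfix 5b5addaa): RankinSelbergPoleCount (stmt-Langlands-17212, crux rank 4) was refuted-MISSTATED by Summit.Langlands.Langlands.Theorems.Ord (planner-rfix-Langlands-OrdinaryPrimeTranspor-5b5addaa-0)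
- 2026-08-16T23:48:31Z · REPAIRED (restate Assembly; drop RankinSelbergPoleCount) — back to open: repair (route-repair rfix 5b5addaa): RankinSelbergPoleCount (stmt-Langlands-17212, crux rank 4) was refuted-MISSTATED by Summit.Langlands.Langlands.Theorems.Ord (planner-rfix-Langlands-OrdinaryPrimeTranspor-5b5addaa-0)
- 2026-08-26T16:14:13Z · DORMANT — reconciler: no traction for 5.5 d (last activity item-evidence-added at 2026-08-21T02:49:19Z); parked, not closed — `ledger route dormant route-Langlands-Ordina (operator:999:353716)
- 2026-08-26T16:59:17Z · REACTIVATED — reconciler: reactivated — activity route-repaired at 2026-08-26T16:14:28Z after parking at 2026-08-26T16:14:13Z (operator:999:3385334)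
- 2026-08-27T15:10:19Z · STALE-VERDICT (tier-A confirmation): L502: Application type mismatch: The argument   Rec has type   ReciprocityData F of sort `Type 1` but is expected to have type   Nonempty (ReciprocityData F) of (operator:gate5)

sub-problem: Langlands · status: open · opened planner-plan-novel-Langlands-Langlands-e266a39d-a-v2-g10-0 2026-08-16T22:53:53Z · rev 14 · ledger route-Langlands-OrdinaryPrimeTransport
GENERATED by the gate from the ledger (D-0016/17). Provers cite these decls: `theorem foo : Summit.Langlands.Langlands.Theses.OrdinaryPrimeTransport.<Decl> := …` in Summits/Langlands/Langlands/Theorems/<Name>.lean.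
-/

namespace Summit.Langlands.Langlands.Theses.OrdinaryPrimeTransport

open scoped BigOperators Topology Manifold Classical MeasureTheory ProbabilityTheory Matrix InnerProductSpace ComplexConjugate ContinuousMap
open Filter Set Function TopologicalSpace MeasureTheory

attribute [summit_statement] _root_.Langlands

/-- item stmt-Langlands-17209 · target · rank 0 · open · by planner
why it might fail: Open ('cuspidal ⇒ irreducible'); as typed it is implied by the summit (Langlands ⇒ irreducibility of every compatible avatar, cf. langlands_iff_reciprocityUpToIrreducibility_and_irreducible), so it closes exhausted, not refuted, unless the Satake-level non-self-duality clause is mistyped.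
sources: arXiv:2607.11763, arXiv:2603.19768, arXiv:2404.08954, arXiv:math/0609460, arXiv:2208.04002
[target] for K totally real or CM, p an odd prime, π cuspidal L-algebraic on GL_p(𝔸_K) with regular
infinity type, not essentially self-dual at Satake level: every ρ : Γ_K → GL_p(ℚ̄_ℓ)
Satake–Frobenius compatible with (π, ι) a.e. is irreducible, for every ℓ, ι. -/
@[route_item "route-Langlands-OrdinaryPrimeTransport"]
def IrreduciblePrimeRank : Prop :=
  ∀ (K : Type) [Field K] [NumberField K], (NumberField.IsTotallyReal K ∨ NumberField.IsCMField K) → ∀ (p : ℕ), Nat.Prime p → 3 ≤ p → ∀ (hcpt : Literature.NumberTheory.Automorphic.isCompact_glFiniteIntegralLevel p K) (π : Literature.NumberTheory.Automorphic.CuspidalAutomorphicRepData p K hcpt), π.1.IsLAlgebraic → (∃ T : Literature.NumberTheory.Automorphic.InfinityType K p, π.1.HasInfinityType T ∧ T.IsRegular) → (∀ (h1 : Literature.NumberTheory.Automorphic.isCompact_glFiniteIntegralLevel 1 K) (η : Literature.NumberTheory.Automorphic.CuspidalAutomorphicRepData 1 K h1), ¬ (∀ᶠ v : IsDedekindDomain.HeightOneSpectrum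 (NumberField.RingOfIntegers K) in Filter.cofinite, ∀ α : Multiset ℂ, π.1.HasSatakeParamAt v α → ∃ e : ℂ, η.1.HasSatakeParamAt v {e} ∧ α.map (fun a => a⁻¹) = α.map (fun a => e * a))) → ∀ (ℓ : ℕ) [Fact ℓ.Prime] (ι : PadicAlgCl ℓ ≃+* ℂ) (ρ : Literature.NumberTheory.GaloisRepresentations.FramedGaloisRep K (PadicAlgCl ℓ) p), (∀ᶠ v : IsDedekindDomain.HeightOneSpectrum (NumberField.RingOfIntegers K) in Filter.cofinite, Summit.Langlands.SatakeFrobCompatibleAt ι π.1 ρ v) → ρ.toGaloisRep.IsIrreducible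

/-- item stmt-Langlands-17210 · crux · rank 2 · open · by planner
why it might fail: Qian Thm 1.4 needs σ̄ abs. irreducible, decomposed generic, enormous image, a scalar element; at a small or badly chosen ordinary prime a hypothetical summand can be residually reducible (Hui 2023 Thm 1.2: type-A summands, almost all λ only); descent to each E must fix the twist.
sources: arXiv:2104.09761, arXiv:1812.09999, arXiv:2208.04002, arXiv:2607.11763, ArthurClozelAMS120
[crux] (the heart; Qian's ordinary potential automorphy run on SUMMANDS) K TR or CM, p odd prime, π
as above; ℓ₀, ι₀ such that SOME compatible avatar ρ₁ is crystalline-ordinary (full flag, unramified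
· ε^b diagonal, b strictly decreasing) at every v ∣ ℓ₀. Then for every compatible avatar ρ₀ at ι₀,
every 0 < k < p, every IRREDUCIBLE framed σ of rank k and framed τ of rank p − k with charpoly ρ₀(g)
= charpoly σ(g) · charpoly τ(g) for all g ∈ Γ_K (exact summand of ρ₀^ss), σ is STRONGLY potentially
automorphic: there is a finite Galois CM extension F'/K with σ|_(F') irreducible such that for every
intermediate E with F'/E solvable there is a cuspidal Π_E on GL_k(𝔸_E) Satake–Frobenius compatible
with σ|_E a.e. [deps: OrdinaryPrimeExists] [difficulty: open-problem] -/
@[route_item "route-Langlands-OrdinaryPrimeTransport", crux]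
def SummandsPotentiallyAutomorphic : Prop :=
  ∀ (K : Type) [Field K] [NumberField K], (NumberField.IsTotallyReal K ∨ NumberField.IsCMField K) → ∀ (p : ℕ), Nat.Prime p → 3 ≤ p → ∀ (hcpt : Literature.NumberTheory.Automorphic.isCompact_glFiniteIntegralLevel p K) (π : Literature.NumberTheory.Automorphic.CuspidalAutomorphicRepData p K hcpt), π.1.IsLAlgebraic → (∃ T : Literature.NumberTheory.Automorphic.InfinityType K p, π.1.HasInfinityType T ∧ T.IsRegular) → ∀ (ℓ₀ : ℕ) [Fact ℓ₀.Prime] (ι₀ : PadicAlgCl ℓ₀ ≃+* ℂ), (∃ ρ₁ : Literature.NumberTheory.GaloisRepresentations.FramedGaloisRep K (PadicAlgCl ℓ₀) p, (∀ᶠ v : IsDedekindDomain.HeightOneSpectrum (NumberField.RingOfIntegers K) in Filter.cofinite, Summit.Langlands.SatakeFrobCompatibleAt ι₀ π.1 ρ₁ v) ∧ ∀ v : IsDedekindDomain.HeightOneSpectrum (NumberField.RingOfIntegers K), ((ℓ₀ : ℕ) : NumberField.RingOfIntegers K) ∈ v.asIdeal → ρ₁.IsCrystallineOrdinaryAt ℓ₀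 v) → ∀ (ρ₀ : Literature.NumberTheory.GaloisRepresentations.FramedGaloisRep K (PadicAlgCl ℓ₀) p), (∀ᶠ v : IsDedekindDomain.HeightOneSpectrum (NumberField.RingOfIntegers K) in Filter.cofinite, Summit.Langlands.SatakeFrobCompatibleAt ι₀ π.1 ρ₀ v) → ∀ (k : ℕ), 0 < k → k < p → ∀ (σ : Literature.NumberTheory.GaloisRepresentations.FramedGaloisRep K (PadicAlgCl ℓ₀) k) (τ : Literature.NumberTheory.GaloisRepresentations.FramedGaloisRep K (PadicAlgCl ℓ₀) (p - k)), σ.toGaloisRep.IsIrreducible → (∀ g : Field.absoluteGaloisGroup K, ρ₀.charpoly g = σ.charpoly g * τ.charpoly g) → ∃ (F' : Type) (_ : Field F') (_ : NumberField F') (_ : Algebra K F') (_ : IsGalois K F'), NumberField.IsCMField F' ∧ (σ.restrictField F').toGaloisRep.IsIrreducible ∧ ∀ (E : Type) [Field E] [NumberField E] [Algebra K E] [Algebra E F'] [IsScalarTower K E F'], IsSolvable (F' ≃ₐ[E] F') → ∃ (hE : Literature.NumberTheory.Automorphic.isCompact_glFiniteIntegralLevel k E) (P : Literature.NumberTheory.Automorphic.CuspidalAutomorphicRepData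 k E hE), ∀ᶠ w : IsDedekindDomain.HeightOneSpectrum (NumberField.RingOfIntegers E) in Filter.cofinite, Summit.Langlands.SatakeFrobCompatibleAt ι₀ P.1 (σ.restrictField E) w

/-- item stmt-Langlands-17211 · crux · rank 3 · open · by planner
why it might fail: Even ONE ordinary prime is open for general π (Calegari arXiv:2109.14145 p.19: Hilbert case 'remains open'); density one of ordinary primes is only heuristic for large Hecke fields; the full-flag predicate wants unramified diagonal characters and, for non-parallel weight, a split ℓ₀.
sources: arXiv:2109.14145, doi:10.1112/mtk.70081, arXiv:2607.11763, Geraghty2018, arXiv:1812.09999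
[crux] (the printed open input) for K TR or CM, p odd prime, π cuspidal L-algebraic with regular
infinity type on GL_p(𝔸_K): there exist a prime ℓ₀, ι₀ : ℚ̄_ℓ₀ ≃ ℂ and a compatible avatar ρ₁ that
is crystalline-ordinary (in the tree's full-flag cyclotomic-exponent sense
`IsCrystallineOrdinaryAt`) at every place v ∣ ℓ₀ — one ordinary prime (for non-parallel weights this
forces ℓ₀ split, which ordinary primes of density one would supply). [difficulty: open-problem] -/
@[route_item "route-Langlands-OrdinaryPrimeTransport", crux]
def OrdinaryPrimeExists : Prop :=
  ∀ (K : Type) [Field K] [NumberField K], (NumberField.IsTotallyReal K ∨ NumberField.IsCMField K) → ∀ (p : ℕ), Nat.Prime p → 3 ≤ p → ∀ (hcpt : Literature.NumberTheory.Automorphic.isCompact_glFiniteIntegralLevel p K) (π : Literature.NumberTheory.Automorphic.CuspidalAutomorphicRepData p K hcpt), π.1.IsLAlgebraic → (∃ T : Literature.NumberTheory.Automorphic.InfinityType K p, π.1.HasInfinityType T ∧ T.IsRegular) → ∃ (ℓ₀ : ℕ) (_ : Fact ℓ₀.Prime) (ι₀ : PadicAlgCl ℓ₀ ≃+* ℂ)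 (ρ₁ : Literature.NumberTheory.GaloisRepresentations.FramedGaloisRep K (PadicAlgCl ℓ₀) p), (∀ᶠ v : IsDedekindDomain.HeightOneSpectrum (NumberField.RingOfIntegers K) in Filter.cofinite, Summit.Langlands.SatakeFrobCompatibleAt ι₀ π.1 ρ₁ v) ∧ ∀ v : IsDedekindDomain.HeightOneSpectrum (NumberField.RingOfIntegers K), ((ℓ₀ : ℕ) : NumberField.RingOfIntegers K) ∈ v.asIdeal → ρ₁.IsCrystallineOrdinaryAt ℓ₀ v

/-- item stmt-Langlands-17870 · crux · rank 4 · open · by planner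
why it might fail: Normalisation traps: compatibility is arithmetic-Frobenius L-normalised, JS/Shahidi unitary - slopes a_i must be read off |ι det σ_i|; abs. convergence only right of the unitary line; self-twists Π_E ≅ Π_E⊗χ add poles (dim End σ_i); GL_1 summand data may be log-type junk in the tree model.
sources: arXiv:1307.1640, doi:10.4007/annals.2014.179.2.3, JacquetShalikaAJM1981, ShahidiAJM1981, doi:10.4007/annals.2010.171.779
[crux] REPAIRED RankinSelbergPoleCount (stmt-Langlands-17212, refuted-misstated 2026-08-16 by
Theorems.OrdinaryPrimeTransportRankinSelbergPoleCount_refuted: no rank guard — n = 0 witness π₀ =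
ℂ·1/0 on GL_0(𝔸_ℚ), ρ₀ = 1 of rank 0 'not irreducible', summand clause 0 < k < 0 empty): the SAME
statement with the guard `2 ≤ n` right after the binder (n : ℕ) (the informal m ≥ 2; n = 1 is
vacuous since rank-one avatars are irreducible); the refuted decl stays in the file as a settled
negative and implies this one. (purity-free Patrikis–Taylor count; any n ≥ 2, any number field K) π
cuspidal on GL_n(𝔸_K), ρ₀ a compatible avatar at ι₀ that is NOT irreducible, such that every
irreducible exact framed summand σ (0 < k < n, charpoly ρ₀ = charpoly σ · charpoly τ on Γ_K) is
strongly potentially automorphic (as in SummandsPotentiallyAutomorphic) — contradiction. Proof line: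
decompose ρ₀^ss = ⊕σ_i (m ≥ 2); each σ_i has a real slope a_i (|ι₀ det σ_i(Frob_v)| = N(v)^(-k_i
a_i) a.e., read off the central characters of the Π^i_E), and n·a_π = Σ k_i a_i; Brauer over
Gal(F'/K) writes D_(σ_i⊗σ̄_j)(s) = ∏_E L^S(s + a_i + a_j, Π^i_(E,u) × Π̃^j_(E,u) ⊗ χ_E)^(n_E)
(complex conjugation, not contragredient, so -/
@[route_item "route-Langlands-OrdinaryPrimeTransport", crux]
def RankinSelbergPoleCountR : Prop :=
  ∀ (n : ℕ), 2 ≤ n → ∀ (K : Type) [Field K] [NumberField K] (hcpt : Literature.NumberTheory.Automorphic.isCompact_glFiniteIntegralLevel n K) (π : Literature.NumberTheory.Automorphic.CuspidalAutomorphicRepData n K hcpt) (ℓ₀ : ℕ) [Fact ℓ₀.Prime] (ι₀ : PadicAlgCl ℓ₀ ≃+* ℂ) (ρ₀ : Literature.NumberTheory.GaloisRepresentations.FramedGaloisRep K (PadicAlgCl ℓ₀) n), (∀ᶠ v : IsDedekindDomain.HeightOneSpectrum (NumberField.RingOfIntegers K) in Filter.cofinite, Summit.Langlands.SatakeFrobCompatibleAt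 ι₀ π.1 ρ₀ v) → ¬ ρ₀.toGaloisRep.IsIrreducible → (∀ (k : ℕ), 0 < k → k < n → ∀ (σ : Literature.NumberTheory.GaloisRepresentations.FramedGaloisRep K (PadicAlgCl ℓ₀) k) (τ : Literature.NumberTheory.GaloisRepresentations.FramedGaloisRep K (PadicAlgCl ℓ₀) (n - k)), σ.toGaloisRep.IsIrreducible → (∀ g : Field.absoluteGaloisGroup K, ρ₀.charpoly g = σ.charpoly g * τ.charpoly g) → ∃ (F' : Type) (_ : Field F') (_ : NumberField F') (_ : Algebra K F') (_ : IsGalois K F'), NumberField.IsCMField F' ∧ (σ.restrictField F').toGaloisRep.IsIrreducible ∧ ∀ (E : Type) [Field E] [NumberField E] [Algebra K E] [Algebra E F'] [IsScalarTower K E F'], IsSolvable (F' ≃ₐ[E] F') → ∃ (hE : Literature.NumberTheory.Automorphic.isCompact_glFiniteIntegralLevel k E) (P : Literature.NumberTheory.Automorphic.CuspidalAutomorphicRepData k E hE), ∀ᶠ w : IsDedekindDomain.HeightOneSpectrum (NumberField.RingOfIntegers E) in Filter.cofinite, Summit.Langlands.SatakeFrobCompatibleAt ι₀ P.1 (σ.restrictField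 E) w) → False

/-- item stmt-Langlands-17213 · crux · rank 5 · open · by planner
why it might fail: Hui 2013 Thm 3.19 is stated for ℚ-rational systems over all ℓ (E-rational λ-adic case = Rem. 1.8 only); the prime-dimensional multiplicity-free list must be complete incl. non-connected G; 'similitude c de Rham ⇒ Hecke character ⇒ Satake self-duality a.e.' needs η over ALL GL(1) data.
sources: arXiv:1204.5271, arXiv:2208.04002, arXiv:2607.11763, SerreAbelianLadic1968, arXiv:1411.6280, HarrisLanTaylorThorneRMS2016
[crux] (Hui transport in prime rank) K TR or CM, p odd prime, π cuspidal L-algebraic with regular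
infinity type, not essentially self-dual at Satake level; if at ONE prime (ℓ₀, ι₀) every compatible
avatar is irreducible, then at EVERY (ℓ, ι) every compatible avatar is irreducible. Proof line: the
avatars form a semisimple E-rational Serre compatible system (Clozel; HLTT/Scholze; p odd so L =
C-algebraic); torus case (G⁰ a torus): Serre's abelian theory ⇒ induced from one Hecke character of
a degree-p extension, irreducible at all λ iff at one; else Clifford + p prime ⇒ Lie-irreducible at
λ₀, Hodge–Tate regular (AHTW Thm 1.2.1, via a CM quadratic extension when K is totally real) ⇒
weight-multiplicity-free prime-dimensional irrep of a simple group ⇒ SL_p (std/dual), Sym^(p−1)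
SL_2, SO_p or G_2 (p = 7); the last three preserve a symmetric form, so G ⊂ GO_p and r ≅ r^∨ ⊗ c
with c de Rham ⇒ π essentially self-dual at Satake level — excluded; hence G^der_(λ₀) = SL_p of
semisimple rank p − 1, λ-independent (Hui 2013 Thm 3.19), while a reducible λ has semisimple rank ≤
p − 2. [difficulty: L] -/
@[route_item "route-Langlands-OrdinaryPrimeTransport", crux]
def PrimeRankTransport : Prop :=
  ∀ (K : Type) [Field K] [NumberField K], (NumberField.IsTotallyReal K ∨ NumberField.IsCMField K) → ∀ (p : ℕ), Nat.Prime p → 3 ≤ p → ∀ (hcpt : Literature.NumberTheory.Automorphic.isCompact_glFiniteIntegralLevel p K) (π : Literature.NumberTheory.Automorphic.CuspidalAutomorphicRepData p K hcpt), π.1.IsLAlgebraic → (∃ T : Literature.NumberTheory.Automorphic.InfinityType K p, π.1.HasInfinityType T ∧ T.IsRegular) → (∀ (h1 : Literature.NumberTheory.Automorphic.isCompact_glFiniteIntegralLevel 1 K) (η : Literature.NumberTheory.Automorphic.CuspidalAutomorphicRepData 1 K h1), ¬ (∀ᶠ v : IsDedekindDomain.HeightOneSpectrum (NumberField.RingOfIntegers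 K) in Filter.cofinite, ∀ α : Multiset ℂ, π.1.HasSatakeParamAt v α → ∃ e : ℂ, η.1.HasSatakeParamAt v {e} ∧ α.map (fun a => a⁻¹) = α.map (fun a => e * a))) → (∃ (ℓ₀ : ℕ) (_ : Fact ℓ₀.Prime) (ι₀ : PadicAlgCl ℓ₀ ≃+* ℂ), ∀ ρ₀ : Literature.NumberTheory.GaloisRepresentations.FramedGaloisRep K (PadicAlgCl ℓ₀) p, (∀ᶠ v : IsDedekindDomain.HeightOneSpectrum (NumberField.RingOfIntegers K) in Filter.cofinite, Summit.Langlands.SatakeFrobCompatibleAt ι₀ π.1 ρ₀ v) → ρ₀.toGaloisRep.IsIrreducible) → ∀ (ℓ : ℕ) [Fact ℓ.Prime] (ι : PadicAlgCl ℓ ≃+* ℂ) (ρ : Literature.NumberTheory.GaloisRepresentations.FramedGaloisRep K (PadicAlgCl ℓ) p), (∀ᶠ v : IsDedekindDomain.HeightOneSpectrum (NumberField.RingOfIntegers K) in Filter.cofinite, Summit.Langlands.SatakeFrobCompatibleAt ι π.1 ρ v) → ρ.toGaloisRep.IsIrreducible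

/-- item stmt-Langlands-14328 · crux · rank 9 · open · by planner
why it might fail: OPEN PROBLEM: reciprocity for GL_n over every number field in BOTH directions minus irreducibility/uniqueness (Buzzard–Gee Conj. 3.2.1/3.2.2 + Fontaine–Mazur–Langlands); p78886 certifies Langlands ↔ this ∧ irreducibility.
sources: BuzzardGeeLMS2014, FontaineMazurGeometric1995, HarrisLanTaylorThorneRMS2016, arXiv:2109.14145
[support] THE REST OF THE MOUNTAIN, part 1 (shared with every Langlands route; the
AdjointEulerNumerical / LiftDescend / CMFern targets imply it): for every number field F ONE datum
Rec such that for every n >= 1, hcpt: every L-algebraic cuspidal pi of GL_n(A_F) has, for all l,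
iota, SOME geometric rho (not asserted irreducible, no uniqueness clause) with `Corresponds Rec iota
pi rho`, AND `GaloisToAutomorphic n Rec hcpt` verbatim. Open (both directions of the summit minus
irreducibility/uniqueness). [difficulty: open-problem] -/
@[route_item "route-Langlands-OrdinaryPrimeTransport", crux]
def ReciprocityUpToIrreducibility : Prop :=
  ∀ (F : Type) [Field F] [NumberField F], ∃ Rec : ReciprocityData F, ∀ n : ℕ, 0 < n → ∀ hcpt : Literature.NumberTheory.Automorphic.isCompact_glFiniteIntegralLevel n F, (∀ π : Literature.NumberTheory.Automorphic.CuspidalAutomorphicRepData n F hcpt, π.1.IsLAlgebraic → ∀ (ℓ : ℕ) [Fact ℓ.Prime] (ι : PadicAlgCl ℓ ≃+* ℂ), ∃ ρ : Literature.NumberTheory.GaloisRepresentations.FramedGaloisRep F (PadicAlgCl ℓ) n, IsGeometricFramed Rec ρ ∧ Corresponds Rec ι π.1 ρ) ∧ GaloisToAutomorphic n Rec hcpt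

/-- item stmt-Langlands-17214 · crux · rank 9 · open · by planner
why it might fail: OPEN component: 'cuspidal ⇒ irreducible' off the prime-rank sector (composite n, general K, irregular or essentially self-dual π); known only for n ≤ 4 totally real, polarized n ≤ 6 (almost all λ), density-one ι — implied by the summit, closes exhausted not refuted.
sources: arXiv:math/0609460, BockleHui2025, arXiv:2208.04002, arXiv:1307.1640, arXiv:2603.19768
[support] THE REST OF THE IRREDUCIBILITY CLAUSE (open component, shared in spirit with
stmt-Langlands-14329): for every n ≥ 1, number field K, cuspidal L-algebraic π of GL_n(𝔸_K) NOT in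
the sector (K TR∨CM ∧ n odd prime ∧ regular infinity type ∧ not essentially self-dual), every
a.e.-compatible avatar at every (ℓ, ι) is irreducible. Not attacked by this route; implied by the
summit; filed so that `closes` decides `Langlands` honestly (same convention as
IrreducibilityBySelfDuality.IrreducibleOffSector, EisensteinMonodromy.MonodromyToLanglands,
PicardMuOrdinary.SectorComplement). [difficulty: open-problem] -/
@[route_item "route-Langlands-OrdinaryPrimeTransport", crux]
def IrreducibleOffPrimeRankSector : Prop :=
  ∀ (n : ℕ) (K : Type) [Field K] [NumberField K] (hcpt : Literature.NumberTheory.Automorphic.isCompact_glFiniteIntegralLevel n K), 0 < n → ∀ (π : Literature.NumberTheory.Automorphic.CuspidalAutomorphicRepData n K hcpt), π.1.IsLAlgebraic → ¬ ((NumberField.IsTotallyReal K ∨ NumberField.IsCMField K) ∧ Nat.Prime n ∧ 3 ≤ n ∧ (∃ T : Literature.NumberTheory.Automorphic.InfinityType K n, π.1.HasInfinityType T ∧ T.IsRegular) ∧ ∀ (h1 : Literature.NumberTheory.Automorphic.isCompact_glFiniteIntegralLevel 1 K) (η : Literature.NumberTheory.Automorphic.CuspidalAutomorphicRepData 1 K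 h1), ¬ (∀ᶠ v : IsDedekindDomain.HeightOneSpectrum (NumberField.RingOfIntegers K) in Filter.cofinite, ∀ α : Multiset ℂ, π.1.HasSatakeParamAt v α → ∃ e : ℂ, η.1.HasSatakeParamAt v {e} ∧ α.map (fun a => a⁻¹) = α.map (fun a => e * a))) → ∀ (ℓ : ℕ) [Fact ℓ.Prime] (ι : PadicAlgCl ℓ ≃+* ℂ) (ρ : Literature.NumberTheory.GaloisRepresentations.FramedGaloisRep K (PadicAlgCl ℓ) n), (∀ᶠ v : IsDedekindDomain.HeightOneSpectrum (NumberField.RingOfIntegers K) in Filter.cofinite, Summit.Langlands.SatakeFrobCompatibleAt ι π.1 ρ v) → ρ.toGaloisRep.IsIrreducible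

/-- item stmt-Langlands-17318 · crux · rank 9 · open · by planner
why it might fail: Known theorem (Satake uniqueness + Chebotarev + Brauer–Nesbitt), crux-kinded only because `closes` may assume crux items; false only if mistyped. HAZARD: a proof importing LAdicRepFrobenius/ChebotarevArtinRepHolds/AutomorphicRepsGLSatakeFlathProofs re-dirties the route's import cone.
sources: DeligneSerreASENS1974, SerreAbelianLadic1968, TateGCFT1967, BuzzardGeeLMS2014
[support] UNIQUENESS UP TO CONJUGACY (cone repair 2026-08-16; formerly proved inline in `closes`):
for every n, number field F, level witness hcpt, cuspidal π on GL_n(𝔸_F), ℓ, ι and two framed ρ, ρ'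
: Γ_F → GL_n(ℚ̄_ℓ), both IRREDUCIBLE and both Satake–Frobenius compatible with (π, ι) at almost all
places, ρ' is GL_n(ℚ̄_ℓ)-conjugate to ρ (`Summit.Langlands.IsConjugate`, the uniqueness clause of
direction (A)). Known (Deligne–Serre 1974 Lemme 3.2 / Serre, Abelian ℓ-adic representations I §2.3):
uniqueness of the Satake parameter (`hasSatakeParamAt_unique`) ⇒ equal Frobenius characteristic
polynomials a.e. ⇒ equal traces on a dense set (Chebotarev, `chebotarev_artinRep`,
`absoluteGaloisGroup.frobenius_dense`) ⇒ equal characters ⇒ equivalent (Brauer–Nesbitt in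
characteristic 0 for semisimple representations,
`Literature.RepresentationTheory.Semisimple.EquivOfCharacter`) ⇒ conjugate
(`FramedRep.exists_eq_conj_of_equiv`, FramedRepEquivConj). A 25-line proof is verbatim the Step 2 of
the pre-repair glue (git history of this Theses file, rev 3) and direction ← of
Theorems/IrreducibilityBySelfDualityReciprocityUpToIrreducibility.lean. CONE DISCIPLINE (why this is
an item and not inline): th -/
@[route_item "route-Langlands-OrdinaryPrimeTransport", crux]
def IrreducibleAvatarsConjugate : Prop :=
  ∀ (n : ℕ) (F : Type) [Field F] [NumberField F] (hcpt : Literature.NumberTheory.Automorphic.isCompact_glFiniteIntegralLevel n F) (π : Literature.NumberTheory.Automorphic.CuspidalAutomorphicRepData n F hcpt) (ℓ : ℕ) [Fact ℓ.Prime] (ι : PadicAlgCl ℓ ≃+* ℂ) (ρ ρ' : Literature.NumberTheory.GaloisRepresentations.FramedGaloisRep F (PadicAlgCl ℓ) n), ρ.toGaloisRep.IsIrreducible → ρ'.toGaloisRep.IsIrreducible → (∀ᶠ v : IsDedekindDomain.HeightOneSpectrum (NumberField.RingOfIntegers F) in Filter.cofinite, Summit.Langlands.SatakeFrobCompatibleAt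 ι π.1 ρ v) → (∀ᶠ v : IsDedekindDomain.HeightOneSpectrum (NumberField.RingOfIntegers F) in Filter.cofinite, Summit.Langlands.SatakeFrobCompatibleAt ι π.1 ρ' v) → Summit.Langlands.IsConjugate ρ ρ'

/-- item stmt-Langlands-23603 · support · rank 9 · open · by planner
sources: Henniart1993, HenniartBSMF2002, Shalika1974, HarrisTaylorAMS2001, BuzzardGeeLMS2014
[support] [piece R of the L∤R split; verbatim the registered stub
`…CompatibilityAwayFromLR.Birth.stub_recRigidity`; WEAKER (L∤R forces it: landed
`Theorems/CompatibilityAwayFromLR/Negative/RigidOfCompatibilityAwayFromLR.lean`,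
`recGL_eq_of_compatibilityAwayFromLR`); leaf ATTACKABLE closed-mod-print: conclusion of the landed
glue `ReciprocityUpToIrreducibilityR.stub_recRigidityLAlg_of_genericRigidity ∘
stub_genericRigidity_of_facts` from five local facts (localLanglands_gl, generic preimages, Henniart
2002 Thm 1.7(a) / 1.6(b), invariant measures); critic: CLEARED decomp-langlands-crit-1-g0 0
2026-08-30T01:15:58Z (pub/decomp-langlands/STATUS.md; CRITIC-LEDGER.md row 01:15:58Z)] any two
pinned reciprocity data give the same class rec_v(π_v) to every local component of every L-algebraic
cuspidal π (Henniart's uniqueness of rec_v on generic classes; local components of cusp forms are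
generic by Shalika). [difficulty: provable-now] -/
@[route_item "route-Langlands-OrdinaryPrimeTransport", crux]
def RecRigidity : Prop :=
  ∀ (K : Type) [Field K] [NumberField K] (Rec Rec' : ReciprocityData K) (n : ℕ) (hcpt : Literature.NumberTheory.Automorphic.isCompact_glFiniteIntegralLevel n K), 0 < n → ∀ (π : Literature.NumberTheory.Automorphic.CuspidalAutomorphicRepData n K hcpt), π.1.IsLAlgebraic → ∀ (v : IsDedekindDomain.HeightOneSpectrum (NumberField.RingOfIntegers K)) (πv : Literature.NumberTheory.Automorphic.SmoothIrrep (Matrix.GeneralLinearGroup (Fin n) (v.adicCompletion K))), π.1.HasLocalComponentAt v πv.ρ → (Rec.llc v).recGL n (Literature.NumberTheory.Automorphic.IrrClass.mk πv) = (Rec'.llc v).recGL n (Literature.NumberTheory.Automorphic.IrrClass.mk πv)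

-- earlier Assembly (stmt-Langlands-17215, replaced 2026-08-16T23:18:19Z -> stmt-Langlands-17399): retired by None — SummandsPotentiallyAutomorphic → OrdinaryPrimeExists → RankinSelbergPoleCount → PrimeRankTransport → IrreducibleOffPrimeRankSector → ReciprocityUpToIrreducibility → _root_.Langlands
-- earlier Assembly (stmt-Langlands-17399, replaced 2026-08-16T23:48:31Z -> stmt-Langlands-18030): retired by None — SummandsPotentiallyAutomorphic → OrdinaryPrimeExists → RankinSelbergPoleCount → PrimeRankTransport → IrreducibleOffPrimeRankSector → ReciprocityUpToIrreducibility → IrreducibleAvatarsConjugate → _root_.Langlands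
/-- item stmt-Langlands-18030 · assembly · rank 1 · open · by planner
sources: BuzzardGeeLMS2014, arXiv:1204.5271, arXiv:2104.09761
[assembly] SummandsPotentiallyAutomorphic → OrdinaryPrimeExists → RankinSelbergPoleCountR →
PrimeRankTransport → IrreducibleOffPrimeRankSector → ReciprocityUpToIrreducibility →
IrreducibleAvatarsConjugate → Langlands (pure logic: the term of `closes`; repair 2026-08-16: the
refuted-misstated RankinSelbergPoleCount replaced by the rank-guarded RankinSelbergPoleCountR). -/
@[route_item "route-Langlands-OrdinaryPrimeTransport"]
def Assembly : Prop :=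
  SummandsPotentiallyAutomorphic → OrdinaryPrimeExists → RankinSelbergPoleCountR → PrimeRankTransport → IrreducibleOffPrimeRankSector → ReciprocityUpToIrreducibility → IrreducibleAvatarsConjugate → _root_.Langlands

-- records of items no longer active in this route (dropped / restated):
-- earlier RankinSelbergPoleCount (stmt-Langlands-17212, dropped 2026-08-16T23:48:31Z): refuted by Summit.Langlands.Langlands.Theorems.OrdinaryPrimeTransportRankinSelbergPoleCount_refuted @ 26619e848e1d — ∀ (n : ℕ) (K : Type) [Field K] [NumberField K] (hcpt : Literature.NumberTheory.Automorphic.isCompact_glFiniteIntegralLevel n K) (π : Literature.NumberTheory.Automorphic.CuspidalAutomorphicRepData n 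

/-! D-0027 §2.1 — DECIDING THEOREM (planner-authored via `route open/edit --closes-file`; by operator:999:3673689 2026-08-31T08:07:46Z):
its hypotheses are this route's items and its conclusion the sub-problem Statement (glue_lint), and it elaborates with this file. -/

/-- D-0027 §2.1 deciding theorem of route OrdinaryPrimeTransport — REPAIRED 2026-08-31 against the summit
as re-typed 2026-08-16 (`∀ F, Nonempty (ReciprocityData F) ∧ ∀ 𝓡 n, 0 < n → ∀ hcpt, (A) ∧ (B)`; the rev-13 text
ended `obtain ⟨Rec, hRec⟩ := hE F; refine ⟨Rec, …⟩` in the `∃ 𝓡` shape and no longer elaborated, L502–503).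
Steps 0–1 are kept verbatim (X = irreducibility on the prime-rank sector from the ordinary prime, the
Rankin–Selberg pole count, potential automorphy of summands and prime-rank transport; irreducibility of every
a.e.-compatible avatar on and off the sector); Step 2 now yields ONE-DATUM reciprocity for the datum `R` of
`ReciprocityUpToIrreducibility` (uniqueness clause by `IrreducibleAvatarsConjugate`), whence
`Nonempty (ReciprocityData F)`, and TRANSFERS it to EVERY pinned datum along the shared support item
`RecRigidity` (= stmt-Langlands-23603: any two pinned data give the same class to every local component of every
L-algebraic cuspidal `π`): `IsGeometricFramed` and the `v ∣ ℓ` clause read the pinned Fontaine datum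
(definitional agreement), the Satake clause is datum-free, the rec-class clause is rewritten in both directions
(so the uniqueness clause of (A) transfers too). Only Statement-level definitions are unfolded; no new import.
The target `IrreduciblePrimeRank` is derived inside (Step 0), the bookkeeping `Assembly` is not a hypothesis. -/
@[closes "route-Langlands-OrdinaryPrimeTransport"] theorem closes (hPA : SummandsPotentiallyAutomorphic) (hOrd : OrdinaryPrimeExists)
    (hRS : RankinSelbergPoleCountR) (hT : PrimeRankTransport)
    (hOff : IrreducibleOffPrimeRankSector) (hE : ReciprocityUpToIrreducibility)
    (hU : IrreducibleAvatarsConjugate) (hRR : RecRigidity) :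
    _root_.Langlands := by
  classical
  -- Step 0: the target X (irreducibility on the prime-rank sector) from the four cruxes.
  have hX : IrreduciblePrimeRank := by
    intro K _ _ hK p hp h3 hcpt π hL hreg hnsd ℓ _ ι ρ hρ
    -- the ordinary prime
    obtain ⟨ℓ₀, hF₀, ι₀, ρ₁, hρ₁, hord⟩ := hOrd K hK p hp h3 hcpt π hL hreg
    haveI : Fact ℓ₀.Prime := hF₀
    -- irreducibility at that prime: the pole count (ranks ≥ 2; here p ≥ 3) kills every
    -- reducible compatible avatar
    have hone : ∀ ρ₀ : Literature.NumberTheory.GaloisRepresentations.FramedGaloisRep K (PadicAlgCl ℓ₀) p,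
        (∀ᶠ v : IsDedekindDomain.HeightOneSpectrum (NumberField.RingOfIntegers K) in Filter.cofinite,
          Summit.Langlands.SatakeFrobCompatibleAt ι₀ π.1 ρ₀ v) → ρ₀.toGaloisRep.IsIrreducible := by
      intro ρ₀ hρ₀
      by_contra hnot
      exact hRS p (Nat.le_of_succ_le h3) K hcpt π ℓ₀ ι₀ ρ₀ hρ₀ hnot
        (fun k hk hkn σ τ hσ hchar =>
          hPA K hK p hp h3 hcpt π hL hreg ℓ₀ ι₀ ⟨ρ₁, hρ₁, hord⟩ ρ₀ hρ₀ k hk hkn σ τ hσ hchar)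
    -- transport to every prime
    exact hT K hK p hp h3 hcpt π hL hreg hnsd ⟨ℓ₀, hF₀, ι₀, hone⟩ ℓ ι ρ hρ
  -- Step 1: irreducibility of EVERY a.e.-compatible avatar of EVERY L-algebraic cuspidal π
  -- (on the sector by hX, off it by the open component hOff).
  have irrAll : ∀ (n : ℕ) (K : Type) [Field K] [NumberField K]
      (hcpt : Literature.NumberTheory.Automorphic.isCompact_glFiniteIntegralLevel n K), 0 < n →
      ∀ (π : Literature.NumberTheory.Automorphic.CuspidalAutomorphicRepData n K hcpt), π.1.IsLAlgebraic →
      ∀ (ℓ : ℕ) [Fact ℓ.Prime] (ι : PadicAlgCl ℓ ≃+* ℂ)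
        (ρ : Literature.NumberTheory.GaloisRepresentations.FramedGaloisRep K (PadicAlgCl ℓ) n),
        (∀ᶠ v : IsDedekindDomain.HeightOneSpectrum (NumberField.RingOfIntegers K) in Filter.cofinite,
          Summit.Langlands.SatakeFrobCompatibleAt ι π.1 ρ v) → ρ.toGaloisRep.IsIrreducible := by
    intro n K _ _ hcpt hn π hL ℓ _ ι ρ hρ
    by_cases hS : ((NumberField.IsTotallyReal K ∨ NumberField.IsCMField K) ∧ Nat.Prime n ∧ 3 ≤ n ∧
        (∃ T : Literature.NumberTheory.Automorphic.InfinityType K n, π.1.HasInfinityType T ∧ T.IsRegular) ∧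
        ∀ (h1 : Literature.NumberTheory.Automorphic.isCompact_glFiniteIntegralLevel 1 K)
          (η : Literature.NumberTheory.Automorphic.CuspidalAutomorphicRepData 1 K h1),
          ¬ (∀ᶠ v : IsDedekindDomain.HeightOneSpectrum (NumberField.RingOfIntegers K) in Filter.cofinite,
              ∀ α : Multiset ℂ, π.1.HasSatakeParamAt v α →
                ∃ e : ℂ, η.1.HasSatakeParamAt v {e} ∧ α.map (fun a => a⁻¹) = α.map (fun a => e * a)))
    · obtain ⟨hK, hp, h3, hreg, hnsd⟩ := hS
      exact hX K hK n hp h3 hcpt π hL hreg hnsd ℓ ι ρ hρ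
    · exact hOff n K hcpt hn π hL hS ℓ ι ρ hρ
  -- Step 2: the rest of the mountain plus irreducibility gives one-datum reciprocity for the datum
  -- `R` of hE (uniqueness up to conjugacy of the irreducible compatible avatars is the support item
  -- hU); `Nonempty (ReciprocityData F)` from `R`.
  intro F _ _
  obtain ⟨R, hRone⟩ := hE F
  have hR : ∀ n : ℕ, 0 < n →
      ∀ hcpt : Literature.NumberTheory.Automorphic.isCompact_glFiniteIntegralLevel n F,
        GlobalLanglandsCorrespondenceGLn n F R hcpt := by
    intro n hn hcpt
    obtain ⟨hA, hB⟩ := hRone n hn hcpt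
    refine ⟨?_, hB⟩
    intro π hL ℓ _ ι
    have irr : ∀ ρ : Literature.NumberTheory.GaloisRepresentations.FramedGaloisRep F (PadicAlgCl ℓ) n,
        (∀ᶠ v : IsDedekindDomain.HeightOneSpectrum (NumberField.RingOfIntegers F) in Filter.cofinite,
          Summit.Langlands.SatakeFrobCompatibleAt ι π.1 ρ v) → ρ.toGaloisRep.IsIrreducible :=
      fun ρ hρ => irrAll n F hcpt hn π hL ℓ ι ρ hρ
    obtain ⟨ρ, hgeo, hcorr⟩ := hA π hL ℓ ι
    exact ⟨ρ, irr ρ hcorr.1, hgeo, hcorr, fun ρ' hcorr' =>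
      hU n F hcpt π ℓ ι ρ ρ' (irr ρ hcorr.1) (irr ρ' hcorr'.1) hcorr.1 hcorr'.1⟩
  refine ⟨⟨R⟩, fun Rec n hn hcpt => ?_⟩
  -- TRANSFER from the one datum `R` to the arbitrary pinned datum `Rec` along `RecRigidity`:
  -- `IsGeometricFramed` and the `v ∣ ℓ` clause read the pinned Fontaine datum (`ReciprocityData.pst`
  -- ignores its argument ⇒ definitional agreement), the Satake clause is datum-free, and the one
  -- datum-dependent clause `rℂ.HasFrobSemisimpleClass (rec_v π_v)` is rewritten along `RecRigidity`.
  have hcorrT : ∀ (R₁ R₂ : ReciprocityData F) (ℓ : ℕ) [Fact ℓ.Prime] (ι : PadicAlgCl ℓ ≃+* ℂ)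
      (π : Literature.NumberTheory.Automorphic.CuspidalAutomorphicRepData n F hcpt), π.1.IsLAlgebraic →
      ∀ ρ : Literature.NumberTheory.GaloisRepresentations.FramedGaloisRep F (PadicAlgCl ℓ) n,
        Corresponds R₁ ι π.1 ρ → Corresponds R₂ ι π.1 ρ := by
    intro R₁ R₂ ℓ _ ι π hπ ρ h
    refine ⟨h.1, fun v => ?_⟩
    obtain ⟨πv, r, rℂ, hloc, haway, habove, htrans, hclass⟩ := h.2 v
    refine ⟨πv, r, rℂ, hloc, haway, habove, htrans, ?_⟩
    rw [← hRR F R₁ R₂ n hcpt hn π hπ v πv hloc]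
    exact hclass
  obtain ⟨hA, hB⟩ := hR n hn hcpt
  refine ⟨?_, ?_⟩
  · -- (A) for `Rec`
    intro π hπ ℓ _ ι
    obtain ⟨ρ, hirr, hgeo, hcorr, huniq⟩ := hA π hπ ℓ ι
    exact ⟨ρ, hirr, hgeo, hcorrT R Rec ℓ ι π hπ ρ hcorr,
      fun ρ' h' => huniq ρ' (hcorrT Rec R ℓ ι π hπ ρ' h')⟩
  · -- (B) for `Rec`
    intro ℓ _ ι ρ hirr hgeo
    obtain ⟨π, hπ, hcorr⟩ := hB ℓ ι ρ hirr hgeo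
    exact ⟨π, hπ, hcorrT R Rec ℓ ι π hπ ρ hcorr⟩

end Summit.Langlands.Langlands.Theses.OrdinaryPrimeTransport
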